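/-
Copyright (c) 2026 the pub-hodgecm-mathlib formalisation cell (harness21).  Prover seat hodgecm-mathlib-K2E1-p10 (g4) (free E1 hand routed to L1 by
CHAIR VALVE W4; LEAD F0P6-plan (g14) BATCH #68 (1)), Track B «K2-LIT», hLiu418 = stmt-HodgeConjecture-24832, road `K2_Liu`, socket #42S, organ S1,
(G) organ ROW (ρ-mid), (M2a) chain, brick (C3-c), first half: THE FRAME COORDINATE `κ` ALONG THE INVERSE OF A TRANSPORTED SIEGEL LEVI, and the
Levi row of a single-row reading.  2026-09-04.
-/
import Summits.HodgeConjecture.HodgeConjecture.Theorems.K2LiuWitnessCoordinateLeviRow   -- ★ (C3-κ) `kappa_levi_rows` (brings `tensorEmbLoc`, `iotaD`, `transportSp`, `levi`)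
import Summits.HodgeConjecture.HodgeConjecture.Theorems.K2LiuLocalSWMiddleCellBruhat      -- ★ `isSiegelDelta_inv_of_blkC` (`P_Δ` is inverse-closed, `n = 2`)
import Summits.HodgeConjecture.HodgeConjecture.Theorems.K2LiuSiegelLeviWeylAlgebra        -- ★ `isUnit_det_blkA_blkD` (Levi blocks of a Siegel element are units)
import HarnessLib

/-!
# Crux `HLiu418`, #42S organ S1, (G) organ ROW (ρ-mid), (M2a) chain, brick (C3-c) — first half: `κ(B⁻¹·z)` FROM THE LEVI LETTER `hB`, AND THE
# LEVI ROW OF A SINGLE-ROW READING (`Theorems/K2LiuTensorMiddleCellFrameReading.lean`)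

Cell `hodgecm-mathlib`, crux item hLiu418 = `stmt-HodgeConjecture-24832`; squad K2 ∕ K2Liu; LEAD F0P6-plan (g14) (BATCH #68 (1), 2026-09-04T22:18:44Z:
«(C3-c) = the FRAME READING (iii) of K2Liu-p26 (g2)'s (C3) head `Theorems/K2LiuTensorMiddleCellLeviRow.lean`»); (M2a) lead K2Liu-p26 (g2) ((C3) HEAD BYTES
22:15:07Z: «(C3-c) the frame reading (iii) `κ(B⁻¹·PD·(y ⊔ 0)) = (c_b(y)·a)_b` = ★ (C3-κ) `kappa_levi_rows` at `(k⁻¹, B⁻¹)` ∘ «row `i₀` of the block reading of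
`PD·(y ⊔ 0)`, row `i₁ = 0`»»); consumer F0P2-p07 (g0) (`Theorems/K2LiuNonsplitMiddleProfileRow.lean`, p862456: «WHAT THE READING (C3-c) MUST HAND ME: per
`x ∈ P_Δ` the Levi row `a x` (= `(blkD (matA x⁻¹) j i₀)(w₀)` via ★ (C3-κ) `kappa_levi_rows`)»).  THEOREMS ONLY (no `def`, no instance, no notation, no named-fact
hypothesis, no `sorry`); lane `--supports stmt-HodgeConjecture-24832 --as helper`.

WHY.  In the Levi row §2 of (C3) (`exists_ne_zero_swSectionTensorLoc_flip_mul_nElem_mul_eq_integral_levi`) the test function is evaluated at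
`B⁻¹ ·ᵥ z`, `z = frameLin PD (glue (blkIdx M₂ M₂) x₁ 0)`, where `(B, hB)` is the transported-Levi letter `E′·ι′(k ⊗ 1)·E′⁻¹ = transportSp 𝕋′ (m(B))` of
★ (C3-a) `K2LiuBlockImplementerLeviAction` ((C3-b), K2Liu-p23 (g2), discharges `∃ B, hB` for `k ∈ leviDeltaLoc`).  For the lattice-pair witness the test function
reads `𝟙_{κ⁻¹B₁} − 𝟙_{κ⁻¹B₂}` in the frame coordinate `κ` of ★ (H4)∕(K1), so the row needs **`κ(B⁻¹ ·ᵥ z)`**.  ★ (C3-κ) `K2LiuWitnessCoordinateLeviRow.kappa_levi_rows`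
(F0P2-p07) gives `κ(B ·ᵥ x) = D_p(w₀) ·ᵥ κ(x)` row by row from `hB`; its docstring leaves the instantiation `(p, B) := (p⁻¹, B⁻¹)` («`hB` inverts inside the group»)
to the consumer.  THIS FILE does that inversion ONCE, by name, and then reads the Levi row of a SINGLE-ROW coordinate vector:
* §0 `iotaD_tensorEmbLoc_inv`, `transportSp_levi_inv`, **`leviLetter_inv`** — the letter `hB` at `(p⁻¹, B⁻¹)` from `hB` at `(p, B)`: `ι′`, `· ⊗ 1` (★ `tensorEmbLoc`),
  `transportSp 𝕋′` and `m` (★ `leviHom`) are homomorphisms, so both sides of `hB` invert (Mathlib `conj_inv`); one `map_inv` per declaration, because `iotaD` is an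
  `abbrev` and any `rw`∕`simp` keyed on it inside a larger goal exhausts the default heartbeat budget (measured: > 200 000 in one declaration, < default split).
* §1 **`kappa_levi_rows_inv`** — under the SAME letters `(hTv E′ P hPu κ hK1 p hp B hB)` as ★ `kappa_levi_rows` (same orientation, so (C3-b)'s `hB` plugs in
  unchanged), for every `z ∈ X`: `(κ(B⁻¹ ·ᵥ z)).1 = D_{p⁻¹}(w₀) ·ᵥ (κ z).1`, `.2.1`, `.2.2` likewise, `D_{p⁻¹} = blkD (matA p⁻¹)`.  Inside: `p⁻¹ ∈ P_Δ`
  (★ `isSiegelDelta_iff_blkC_eq_zero`, ★ `isUnit_det_blkA_blkD`, ★ `isSiegelDelta_inv_of_blkC`) and §0's `leviLetter_inv`, then ★ (C3-κ) at `(p⁻¹, B⁻¹)`.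
* §2 **`kappa_inv_levi_of_row_reading`** — if the three coordinate vectors of `z` lie on ONE row vector `u` (`(κ z).1 = α • u`, `(κ z).2.1 = β • u`,
  `(κ z).2.2 = γ • u` — the letter `hz`, BY VALUE), then `κ(B⁻¹ ·ᵥ z) = (α • D_{p⁻¹}(w₀) u, β • D_{p⁻¹}(w₀) u, γ • D_{p⁻¹}(w₀) u)`.
* §3 **`kappa_inv_levi_of_single_row`** — at `u = e_{i₀}` («row `i₀` of the block reading, row `i₁ = 0»):
  `(κ(B⁻¹ ·ᵥ z)).1 = (j ↦ α · D_{p⁻¹}(w₀)_{j i₀})`, `.2.1 = (j ↦ β · …)`, `.2.2 = (j ↦ γ · …)` — EXACTLY the argument shape `(fun j => α * a x j, fun j => β * a x j,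
  fun j => γ * a x j)` with `a x j := (blkD (matA x⁻¹) j i₀)(w₀)` of the consumer's `hrow` letter (F0P2-p07, `K2LiuNonsplitMiddleProfileRow.factorisation_of_leviRow_reading`).
The letter `hz` — the block reading of `PD·(y ⊔ 0)` through the mover `E′ := proj(frameMp_PD(j̃(p₁, p₂)))` — is (C2c) `K2LiuWitnessImplementerCayley`'s output
(K2Liu-p01 (g10) lineage) and is taken BY VALUE here: it is a hypothesis on the specific vector `z`, discharged at the instance, never a `∀` over data
(LEAD RULING M-158j).  Pure bookkeeping: ★ (C3-κ) + group inversion (Mathlib `map_inv`, `conj_inv`) + `Matrix.mulVec_smul` ∕ `Matrix.mulVec_single_one`; default heartbeats throughout.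
References: [Kudla1994] §3 Thm. 3.1; [HarrisKudlaSweet1996] §1 (1.11), (1.15); [MoeglinVignerasWaldspurger1987] Chap. 2 II.2; [Rangarao1993] Lemma 3.2 (3.8).
HONEST LABEL.  Count-neutral helper: `HC_CM` is proved only modulo the 7 printed citations (2 remaining named inputs: hLiu418 = `stmt-HodgeConjecture-24832`,
h413 = `stmt-HodgeConjecture-24833`) until rung 0 closes.  NOT here: the letter `hz` ((C2c)), the discharge `∃ B, hB` ((C3-b)), the Levi row (C3) itself (K2Liu-p26),
the evaluations (F0P2-p07 non-split ∕ K2Liu-p08 split), ★ (M2a-L), ★ (M2b), the (G) assembly.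

## Tree search
★ `kappa_levi_rows` (`Theorems/K2LiuWitnessCoordinateLeviRow.lean` :216), ★ `isSiegelDelta_inv_of_blkC` (`Theorems/K2LiuLocalSWMiddleCellBruhat.lean` :72),
★ `isUnit_det_blkA_blkD` (`Theorems/K2LiuSiegelLeviWeylAlgebra.lean` :56), ★ `isSiegelDelta_iff_blkC_eq_zero` (Literature `LocalDoubledUnitaryIwahori` :125),
★ `leviHom`∕`leviHom_apply` (Literature `SymplecticSiegelGeneration` :105), ★ `iotaD : … →*` (Literature `LocalDoubledUnitaryDatum` :235), ★ `tensorEmbLoc : … →*`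
(`Theorems/K2LiuLocalSWSectionDefs.lean` :76), ★ `transportSp : … →*`; Mathlib `map_inv`, `MonoidHom.map_inv`, `conj_inv`, `Matrix.mulVec_smul`,
`Matrix.mulVec_single_one`, `Matrix.col_apply`.  Dedup: `rg "kappa_levi_rows_inv|kappa_inv_levi|leviLetter_inv|iotaD_tensorEmbLoc_inv|transportSp_levi_inv|FrameReading"`
over `Theorems/` + `Literature/` — none.

## References
* [Kudla1994] S. S. Kudla, *Splitting metaplectic covers of dual reductive pairs*, Israel J. Math. 87 (1994), §3 Thm. 3.1.
* [HarrisKudlaSweet1996] M. Harris, S. Kudla, W. J. Sweet, *Theta dichotomy for unitary groups*, J. Amer. Math. Soc. 9 (1996), §1 (1.11), (1.15).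
* [MoeglinVignerasWaldspurger1987] C. Mœglin, M.-F. Vignéras, J.-L. Waldspurger, *Correspondances de Howe sur un corps p-adique*, LNM 1291 (1987), Chap. 2 II.2.
* [Rangarao1993] R. Ranga Rao, *On some explicit formulas in the theory of Weil representation*, Pacific J. Math. 157 (1993), Lemma 3.2 (3.8).
-/

set_option autoImplicit false
set_option linter.dupNamespace false -- the mandated namespace repeats `HodgeConjecture.HodgeConjecture`

noncomputable section

open scoped Matrix Kronecker
open NumberField IsDedekindDomain Matrix
open Literature.RepresentationTheory.HeisenbergGroup Literature.RepresentationTheory.HeisenbergGroup.SymplecticMatrix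
open Literature.NumberTheory.Automorphic Literature.NumberTheory.Automorphic.UnitaryGroup
open Literature.NumberTheory.GelbartRogawski1991 Literature.NumberTheory.GelbartRogawski1991.GRConstruction
open Literature.NumberTheory.GelbartRogawski1991.UnitaryDualPair
open Literature.NumberTheory.GelbartRogawski1991.UnitaryDualPair.LocalSplitting
open Literature.NumberTheory.GelbartRogawski1991.AdaptedBlocks
open Literature.NumberTheory.K2Lit.SiegelDoubled
open Summit.HodgeConjecture.HodgeConjecture.Cruxes.HLiu418.K2LiuLocalSWSectionDefs
open Summit.HodgeConjecture.HodgeConjecture.Cruxes.HLiu418.K2LiuLocalSWTensorAdaptedBlocks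
open Summit.HodgeConjecture.HodgeConjecture.Cruxes.HLiu418.K2LiuWitnessCoordinateLeviRow (kappa_levi_rows)
open Summit.HodgeConjecture.HodgeConjecture.Cruxes.HLiu418.K2LiuLocalSWMiddleCellBruhat (isSiegelDelta_inv_of_blkC)
open Summit.HodgeConjecture.HodgeConjecture.Cruxes.HLiu418.K2LiuSiegelLeviWeylAlgebra (isUnit_det_blkA_blkD)

namespace Summit.HodgeConjecture.HodgeConjecture.Cruxes.HLiu418.K2LiuTensorMiddleCellFrameReading

variable (L : Type) [Field L] [NumberField L] [IsCMField L]
variable {N M : ℕ} (e : Fin N × Fin M ≃ Fin 2)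
  (dV : Fin N → L) (hdV : ∀ i, IsCMField.complexConj L (dV i) = dV i)
  (dW : Fin M → L) (hdW : ∀ i, IsCMField.complexConj L (dW i) = dW i)
variable {M' n' : ℕ} (eW : Fin M × Fin 3 ≃ Fin M') (e' : Fin N × Fin M' ≃ Fin n')
  (dV' : Fin 3 → L) (hdV' : ∀ k, IsCMField.complexConj L (dV' k) = dV' k)
variable (v : HeightOneSpectrum (𝓞 (Fp L))) (w₀ : PlacesOver L v)

/-! ## §0 The transported-Levi letter inverts (every map in `hB` is a homomorphism) -/

/-- `ι′((p ⊗ 1)⁻¹) = (ι′(p ⊗ 1))⁻¹`: the doubled embedding `ι′ = iotaD` (★ `abbrev … →*`) and `· ⊗ 1 = tensorEmbLoc v` (★ `→*`) are homomorphisms.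
(Stated once so that no `map_inv` is elaborated inside a larger goal — `iotaD` is an `abbrev` and keyed matching unfolds it.)
[cite: Kudla1994, §2 (doubled space, Siegel parabolic)] [cite: MoeglinVignerasWaldspurger1987, Chap. 1 I.17] -/
theorem iotaD_tensorEmbLoc_inv (p : UnitaryGroup.localPi L (IsCMField.complexConj L) (2 + 2) (hermD L e dV hdV dW hdW) v) :
    iotaD (Fp L) L (IsCMField.complexConj L) (complexConj_imagUnit L) (imagUnit_ne_zero L) (imagUnit_mul_self L) v n'
        (gramR_isSymm L e' dV hdV (tensorFrame L dW eW dV') (tensorFrame_real L dW hdW eW dV' hdV'))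
        (hermD_eq_map_gramD L e' dV hdV (tensorFrame L dW eW dV') (tensorFrame_real L dW hdW eW dV' hdV'))
        (tensorEmbLoc L e dV hdV dW hdW eW e' dV' hdV' v p⁻¹) =
      (iotaD (Fp L) L (IsCMField.complexConj L) (complexConj_imagUnit L) (imagUnit_ne_zero L) (imagUnit_mul_self L) v n'
        (gramR_isSymm L e' dV hdV (tensorFrame L dW eW dV') (tensorFrame_real L dW hdW eW dV' hdV'))
        (hermD_eq_map_gramD L e' dV hdV (tensorFrame L dW eW dV') (tensorFrame_real L dW hdW eW dV' hdV'))
        (tensorEmbLoc L e dV hdV dW hdW eW e' dV' hdV' v p))⁻¹ := by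
  have hτ : tensorEmbLoc L e dV hdV dW hdW eW e' dV' hdV' v p⁻¹ = (tensorEmbLoc L e dV hdV dW hdW eW e' dV' hdV' v p)⁻¹ :=
    map_inv (tensorEmbLoc L e dV hdV dW hdW eW e' dV' hdV' v) p
  rw [hτ]
  exact (iotaD (Fp L) L (IsCMField.complexConj L) (complexConj_imagUnit L) (imagUnit_ne_zero L) (imagUnit_mul_self L) v n'
    (gramR_isSymm L e' dV hdV (tensorFrame L dW eW dV') (tensorFrame_real L dW hdW eW dV' hdV'))
    (hermD_eq_map_gramD L e' dV hdV (tensorFrame L dW eW dV') (tensorFrame_real L dW hdW eW dV' hdV'))).map_inv _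

/-- `transportSp 𝕋′ (m(B⁻¹)) = (transportSp 𝕋′ (m(B)))⁻¹`: `m = levi` (★ `leviHom`) and `transportSp 𝕋′` are homomorphisms. [cite: MoeglinVignerasWaldspurger1987, Chap. 2 II.2] -/
theorem transportSp_levi_inv
    (hTv : IsUnit (localGram (Fp L) (n' + n') (gramD (Fp L) n' (gramR L e' dV hdV (tensorFrame L dW eW dV') (tensorFrame_real L dW hdW eW dV' hdV'))) v).det)
    (B : GL (Fin (n' + n')) (v.adicCompletion (Fp L))) :
    transportSp (localGram (Fp L) (n' + n') (gramD (Fp L) n' (gramR L e' dV hdV (tensorFrame L dW eW dV') (tensorFrame_real L dW hdW eW dV' hdV'))) v) hTv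
        (levi B⁻¹) =
      (transportSp (localGram (Fp L) (n' + n') (gramD (Fp L) n' (gramR L e' dV hdV (tensorFrame L dW eW dV') (tensorFrame_real L dW hdW eW dV' hdV'))) v) hTv
        (levi B))⁻¹ := by
  have hlevi : (levi B⁻¹ : Matrix.symplecticGroup (Fin (n' + n')) (v.adicCompletion (Fp L))) = (levi B)⁻¹ :=
    (leviHom_apply B⁻¹).symm.trans ((map_inv leviHom B).trans (congrArg Inv.inv (leviHom_apply B)))
  rw [hlevi]
  exact (transportSp (localGram (Fp L) (n' + n') (gramD (Fp L) n' (gramR L e' dV hdV (tensorFrame L dW eW dV') (tensorFrame_real L dW hdW eW dV' hdV'))) v) hTv).map_inv _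

/-- **THE LEVI LETTER AT `(p⁻¹, B⁻¹)`**: from `hB : E′·ι′(p ⊗ 1)·E′⁻¹ = transportSp 𝕋′ (m(B))` (★ (C3-a)∕(C3-b) orientation) one gets the same letter for
`(p⁻¹, B⁻¹)` — `E′·ι′(p⁻¹ ⊗ 1)·E′⁻¹ = transportSp 𝕋′ (m(B⁻¹))` (invert both sides). [cite: Kudla1994, §3 Thm. 3.1] [cite: MoeglinVignerasWaldspurger1987, Chap. 2 II.2] -/
theorem leviLetter_inv
    (hTv : IsUnit (localGram (Fp L) (n' + n') (gramD (Fp L) n' (gramR L e' dV hdV (tensorFrame L dW eW dV') (tensorFrame_real L dW hdW eW dV' hdV'))) v).det)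
    (E' : LocalSp (Fp L) (n' + n') (gramD (Fp L) n' (gramR L e' dV hdV (tensorFrame L dW eW dV') (tensorFrame_real L dW hdW eW dV' hdV'))) v)
    (p : UnitaryGroup.localPi L (IsCMField.complexConj L) (2 + 2) (hermD L e dV hdV dW hdW) v)
    (B : GL (Fin (n' + n')) (v.adicCompletion (Fp L)))
    (hB : E' * iotaD (Fp L) L (IsCMField.complexConj L) (complexConj_imagUnit L) (imagUnit_ne_zero L) (imagUnit_mul_self L) v n'
        (gramR_isSymm L e' dV hdV (tensorFrame L dW eW dV') (tensorFrame_real L dW hdW eW dV' hdV'))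
        (hermD_eq_map_gramD L e' dV hdV (tensorFrame L dW eW dV') (tensorFrame_real L dW hdW eW dV' hdV'))
        (tensorEmbLoc L e dV hdV dW hdW eW e' dV' hdV' v p) * E'⁻¹ =
      transportSp (localGram (Fp L) (n' + n') (gramD (Fp L) n' (gramR L e' dV hdV (tensorFrame L dW eW dV') (tensorFrame_real L dW hdW eW dV' hdV'))) v) hTv (levi B)) :
    E' * iotaD (Fp L) L (IsCMField.complexConj L) (complexConj_imagUnit L) (imagUnit_ne_zero L) (imagUnit_mul_self L) v n'
        (gramR_isSymm L e' dV hdV (tensorFrame L dW eW dV') (tensorFrame_real L dW hdW eW dV' hdV'))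
        (hermD_eq_map_gramD L e' dV hdV (tensorFrame L dW eW dV') (tensorFrame_real L dW hdW eW dV' hdV'))
        (tensorEmbLoc L e dV hdV dW hdW eW e' dV' hdV' v p⁻¹) * E'⁻¹ =
      transportSp (localGram (Fp L) (n' + n') (gramD (Fp L) n' (gramR L e' dV hdV (tensorFrame L dW eW dV') (tensorFrame_real L dW hdW eW dV' hdV'))) v) hTv
        (levi B⁻¹) :=
  ((congrArg (fun g => E' * g * E'⁻¹) (iotaD_tensorEmbLoc_inv L e dV hdV dW hdW eW e' dV' hdV' v p)).trans conj_inv.symm).trans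
    ((congrArg Inv.inv hB).trans (transportSp_levi_inv L dV hdV dW hdW eW e' dV' hdV' v hTv B).symm)

/-! ## §1 `κ` along the INVERSE of a transported Siegel Levi -/

/-- **(C3-c §1) `κ(B⁻¹ ·ᵥ z)` FROM THE LEVI LETTER `hB`** — ★ (C3-κ) `kappa_levi_rows` at `(p⁻¹, B⁻¹)`, the inversion done here once: with the frame-coordinate
letter (K1) (`P` invertible) and the transported-Levi letter `hB : E′·ι′(p ⊗ 1)·E′⁻¹ = transportSp 𝕋′ (m(B))` for `p ∈ P_Δ(U(𝕍□)_v)` at the tensor datum (SAME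
orientation as ★ `kappa_levi_rows`), for every `z ∈ X`: `(κ(B⁻¹ ·ᵥ z)).1 = D_{p⁻¹}(w₀) ·ᵥ (κ z).1`, `(κ(B⁻¹ ·ᵥ z)).2.1 = D_{p⁻¹}(w₀) ·ᵥ (κ z).2.1`,
`(κ(B⁻¹ ·ᵥ z)).2.2 = D_{p⁻¹}(w₀) ·ᵥ (κ z).2.2`, `D_{p⁻¹} = blkD (matA p⁻¹)` read at `w₀` (`p⁻¹ ∈ P_Δ`: ★ `isSiegelDelta_inv_of_blkC`; `hB` at `(p⁻¹, B⁻¹)`: all four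
maps in `hB` are group homomorphisms). [cite: Kudla1994, §3 Thm. 3.1] [cite: HarrisKudlaSweet1996, §1 (1.11), (1.15)] [cite: MoeglinVignerasWaldspurger1987, Chap. 2 II.2] -/
theorem kappa_levi_rows_inv
    (hTv : IsUnit (localGram (Fp L) (n' + n') (gramD (Fp L) n' (gramR L e' dV hdV (tensorFrame L dW eW dV') (tensorFrame_real L dW hdW eW dV' hdV'))) v).det)
    (E' : LocalSp (Fp L) (n' + n') (gramD (Fp L) n' (gramR L e' dV hdV (tensorFrame L dW eW dV') (tensorFrame_real L dW hdW eW dV' hdV'))) v)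
    (P : Matrix (Fin 3) (Fin 3) (w₀.1.adicCompletion L)) (hPu : IsUnit P.det)
    (κ : (Fin (n' + n') → v.adicCompletion (Fp L)) ≃+ ((Fin 2 → w₀.1.adicCompletion L) × (Fin 2 → w₀.1.adicCompletion L) × (Fin 2 → w₀.1.adicCompletion L)))
    (hK1 : ∀ (x : (Fin (n' + n') → v.adicCompletion (Fp L))) (j : Fin 2), ![(κ x).1 j, (κ x).2.1 j, (κ x).2.2 j] ᵥ* P = fun l => halfDiff ((eD (Fp L) L (IsCMField.complexConj L) (complexConj_imagUnit L) (imagUnit_ne_zero L) (imagUnit_mul_self L) v n').symm (toLin (Fp L) v E'⁻¹ (x, 0))) (epsV e eW e' (j, l)) w₀)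
    (p : UnitaryGroup.localPi L (IsCMField.complexConj L) (2 + 2) (hermD L e dV hdV dW hdW) v)
    (hp : IsSiegelDelta (Fp L) L (IsCMField.complexConj L) (complexConj_imagUnit L) (imagUnit_ne_zero L) (imagUnit_mul_self L) v 2
      (gramR_isSymm L e dV hdV dW hdW) (hermD_eq_map_gramD L e dV hdV dW hdW) p)
    (B : GL (Fin (n' + n')) (v.adicCompletion (Fp L)))
    (hB : E' * iotaD (Fp L) L (IsCMField.complexConj L) (complexConj_imagUnit L) (imagUnit_ne_zero L) (imagUnit_mul_self L) v n'
        (gramR_isSymm L e' dV hdV (tensorFrame L dW eW dV') (tensorFrame_real L dW hdW eW dV' hdV'))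
        (hermD_eq_map_gramD L e' dV hdV (tensorFrame L dW eW dV') (tensorFrame_real L dW hdW eW dV' hdV'))
        (tensorEmbLoc L e dV hdV dW hdW eW e' dV' hdV' v p) * E'⁻¹ =
      transportSp (localGram (Fp L) (n' + n') (gramD (Fp L) n' (gramR L e' dV hdV (tensorFrame L dW eW dV') (tensorFrame_real L dW hdW eW dV' hdV'))) v) hTv (levi B))
    (z : Fin (n' + n') → v.adicCompletion (Fp L)) :
    (κ (((B⁻¹ : GL (Fin (n' + n')) (v.adicCompletion (Fp L))) : Matrix (Fin (n' + n')) (Fin (n' + n')) (v.adicCompletion (Fp L))) *ᵥ z)).1 =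
        (blkD (matA (Fp L) L (IsCMField.complexConj L) v 2 p⁻¹)).map (fun t : LocalRing L v => t w₀) *ᵥ (κ z).1 ∧
      (κ (((B⁻¹ : GL (Fin (n' + n')) (v.adicCompletion (Fp L))) : Matrix (Fin (n' + n')) (Fin (n' + n')) (v.adicCompletion (Fp L))) *ᵥ z)).2.1 =
        (blkD (matA (Fp L) L (IsCMField.complexConj L) v 2 p⁻¹)).map (fun t : LocalRing L v => t w₀) *ᵥ (κ z).2.1 ∧
      (κ (((B⁻¹ : GL (Fin (n' + n')) (v.adicCompletion (Fp L))) : Matrix (Fin (n' + n')) (Fin (n' + n')) (v.adicCompletion (Fp L))) *ᵥ z)).2.2 =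
        (blkD (matA (Fp L) L (IsCMField.complexConj L) v 2 p⁻¹)).map (fun t : LocalRing L v => t w₀) *ᵥ (κ z).2.2 := by
  haveI : Algebra.IsQuadraticExtension (Fp L) L := IsCMField.isQuadraticExtension L
  -- `p⁻¹ ∈ P_Δ`
  have hC : blkC (matA (Fp L) L (IsCMField.complexConj L) v 2 p) = 0 :=
    (isSiegelDelta_iff_blkC_eq_zero (Fp L) L (IsCMField.complexConj L) (complexConj_imagUnit L) (imagUnit_ne_zero L) (imagUnit_mul_self L) v 2
      (gramR_isSymm L e dV hdV dW hdW) (hermD_eq_map_gramD L e dV hdV dW hdW) p).1 hp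
  have hp' : IsSiegelDelta (Fp L) L (IsCMField.complexConj L) (complexConj_imagUnit L) (imagUnit_ne_zero L) (imagUnit_mul_self L) v 2
      (gramR_isSymm L e dV hdV dW hdW) (hermD_eq_map_gramD L e dV hdV dW hdW) p⁻¹ :=
    isSiegelDelta_inv_of_blkC (Fp L) L (IsCMField.complexConj L) (complexConj_imagUnit L) (imagUnit_ne_zero L) (imagUnit_mul_self L) v
      (gramR_isSymm L e dV hdV dW hdW) (hermD_eq_map_gramD L e dV hdV dW hdW) hC
      (isUnit_det_blkA_blkD (Fp L) L (IsCMField.complexConj L) v 2 hC).1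
  -- `hB` at `(p⁻¹, B⁻¹)` (§0) and ★ (C3-κ) there
  exact kappa_levi_rows L e dV hdV dW hdW eW e' dV' hdV' v w₀ hTv E' P hPu κ hK1 p⁻¹ hp' B⁻¹
    (leviLetter_inv L e dV hdV dW hdW eW e' dV' hdV' v hTv E' p B hB) z

/-! ## §2 The Levi row of a single-row reading -/

/-- **(C3-c §2) THE LEVI ROW OF A ONE-ROW READING**: under the letters of §1, if the three coordinate vectors of `z` lie on one row vector `u`
(`(κ z).1 = α • u`, `(κ z).2.1 = β • u`, `(κ z).2.2 = γ • u` — the letter `hz`, BY VALUE; at the instance it is the block reading of `PD·(y ⊔ 0)` through the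
mover, (C2c)), then `κ(B⁻¹ ·ᵥ z) = (α • D_{p⁻¹}(w₀) ·ᵥ u, β • D_{p⁻¹}(w₀) ·ᵥ u, γ • D_{p⁻¹}(w₀) ·ᵥ u)`.
[cite: Kudla1994, §3 Thm. 3.1] [cite: HarrisKudlaSweet1996, §1 (1.11), (1.15)] [cite: Rangarao1993, Lemma 3.2 (3.8)] -/
theorem kappa_inv_levi_of_row_reading
    (hTv : IsUnit (localGram (Fp L) (n' + n') (gramD (Fp L) n' (gramR L e' dV hdV (tensorFrame L dW eW dV') (tensorFrame_real L dW hdW eW dV' hdV'))) v).det)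
    (E' : LocalSp (Fp L) (n' + n') (gramD (Fp L) n' (gramR L e' dV hdV (tensorFrame L dW eW dV') (tensorFrame_real L dW hdW eW dV' hdV'))) v)
    (P : Matrix (Fin 3) (Fin 3) (w₀.1.adicCompletion L)) (hPu : IsUnit P.det)
    (κ : (Fin (n' + n') → v.adicCompletion (Fp L)) ≃+ ((Fin 2 → w₀.1.adicCompletion L) × (Fin 2 → w₀.1.adicCompletion L) × (Fin 2 → w₀.1.adicCompletion L)))
    (hK1 : ∀ (x : (Fin (n' + n') → v.adicCompletion (Fp L))) (j : Fin 2), ![(κ x).1 j, (κ x).2.1 j, (κ x).2.2 j] ᵥ* P = fun l => halfDiff ((eD (Fp L) L (IsCMField.complexConj L) (complexConj_imagUnit L) (imagUnit_ne_zero L) (imagUnit_mul_self L) v n').symm (toLin (Fp L) v E'⁻¹ (x, 0))) (epsV e eW e' (j, l)) w₀)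
    (p : UnitaryGroup.localPi L (IsCMField.complexConj L) (2 + 2) (hermD L e dV hdV dW hdW) v)
    (hp : IsSiegelDelta (Fp L) L (IsCMField.complexConj L) (complexConj_imagUnit L) (imagUnit_ne_zero L) (imagUnit_mul_self L) v 2
      (gramR_isSymm L e dV hdV dW hdW) (hermD_eq_map_gramD L e dV hdV dW hdW) p)
    (B : GL (Fin (n' + n')) (v.adicCompletion (Fp L)))
    (hB : E' * iotaD (Fp L) L (IsCMField.complexConj L) (complexConj_imagUnit L) (imagUnit_ne_zero L) (imagUnit_mul_self L) v n'
        (gramR_isSymm L e' dV hdV (tensorFrame L dW eW dV') (tensorFrame_real L dW hdW eW dV' hdV'))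
        (hermD_eq_map_gramD L e' dV hdV (tensorFrame L dW eW dV') (tensorFrame_real L dW hdW eW dV' hdV'))
        (tensorEmbLoc L e dV hdV dW hdW eW e' dV' hdV' v p) * E'⁻¹ =
      transportSp (localGram (Fp L) (n' + n') (gramD (Fp L) n' (gramR L e' dV hdV (tensorFrame L dW eW dV') (tensorFrame_real L dW hdW eW dV' hdV'))) v) hTv (levi B))
    (z : Fin (n' + n') → v.adicCompletion (Fp L)) (α β γ : w₀.1.adicCompletion L) (u : Fin 2 → w₀.1.adicCompletion L)
    (hz : (κ z).1 = α • u ∧ (κ z).2.1 = β • u ∧ (κ z).2.2 = γ • u) :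
    (κ (((B⁻¹ : GL (Fin (n' + n')) (v.adicCompletion (Fp L))) : Matrix (Fin (n' + n')) (Fin (n' + n')) (v.adicCompletion (Fp L))) *ᵥ z)).1 =
        α • ((blkD (matA (Fp L) L (IsCMField.complexConj L) v 2 p⁻¹)).map (fun t : LocalRing L v => t w₀) *ᵥ u) ∧
      (κ (((B⁻¹ : GL (Fin (n' + n')) (v.adicCompletion (Fp L))) : Matrix (Fin (n' + n')) (Fin (n' + n')) (v.adicCompletion (Fp L))) *ᵥ z)).2.1 =
        β • ((blkD (matA (Fp L) L (IsCMField.complexConj L) v 2 p⁻¹)).map (fun t : LocalRing L v => t w₀) *ᵥ u) ∧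
      (κ (((B⁻¹ : GL (Fin (n' + n')) (v.adicCompletion (Fp L))) : Matrix (Fin (n' + n')) (Fin (n' + n')) (v.adicCompletion (Fp L))) *ᵥ z)).2.2 =
        γ • ((blkD (matA (Fp L) L (IsCMField.complexConj L) v 2 p⁻¹)).map (fun t : LocalRing L v => t w₀) *ᵥ u) := by
  obtain ⟨h1, h2, h3⟩ := kappa_levi_rows_inv L e dV hdV dW hdW eW e' dV' hdV' v w₀ hTv E' P hPu κ hK1 p hp B hB z
  obtain ⟨hz1, hz2, hz3⟩ := hz
  exact ⟨h1.trans (by rw [hz1, Matrix.mulVec_smul]), h2.trans (by rw [hz2, Matrix.mulVec_smul]), h3.trans (by rw [hz3, Matrix.mulVec_smul])⟩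

/-- **(C3-c §3) THE LEVI ROW OF «ROW `i₀`, ROW `i₁ = 0`»** — the shape the evaluations consume: under the letters of §1, if `(κ z).1 = α • e_{i₀}`,
`(κ z).2.1 = β • e_{i₀}`, `(κ z).2.2 = γ • e_{i₀}` (the block reading of `PD·(y ⊔ 0)`: row `i₀` carries `(α, β, γ)`, the other row vanishes — letter `hz`,
(C2c), BY VALUE), then `(κ(B⁻¹ ·ᵥ z)).1 = (j ↦ α · D_{p⁻¹}(w₀)_{j i₀})`, `(κ(B⁻¹ ·ᵥ z)).2.1 = (j ↦ β · D_{p⁻¹}(w₀)_{j i₀})`,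
`(κ(B⁻¹ ·ᵥ z)).2.2 = (j ↦ γ · D_{p⁻¹}(w₀)_{j i₀})` — i.e. `(α·a, β·a, γ·a)` with the Levi row `a j = (blkD (matA p⁻¹) j i₀)(w₀)` of the consumer's `hrow`
(★ `K2LiuNonsplitMiddleProfileRow.factorisation_of_leviRow_reading`, ★ (M2a-L) `K2LiuWitnessLeviReading.indicator_boxOne_sub_boxTwo_levi`).
[cite: Kudla1994, §3 Thm. 3.1] [cite: HarrisKudlaSweet1996, §1 (1.11), (1.15)] [cite: Rangarao1993, Lemma 3.2 (3.8)] -/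
theorem kappa_inv_levi_of_single_row
    (hTv : IsUnit (localGram (Fp L) (n' + n') (gramD (Fp L) n' (gramR L e' dV hdV (tensorFrame L dW eW dV') (tensorFrame_real L dW hdW eW dV' hdV'))) v).det)
    (E' : LocalSp (Fp L) (n' + n') (gramD (Fp L) n' (gramR L e' dV hdV (tensorFrame L dW eW dV') (tensorFrame_real L dW hdW eW dV' hdV'))) v)
    (P : Matrix (Fin 3) (Fin 3) (w₀.1.adicCompletion L)) (hPu : IsUnit P.det)
    (κ : (Fin (n' + n') → v.adicCompletion (Fp L)) ≃+ ((Fin 2 → w₀.1.adicCompletion L) × (Fin 2 → w₀.1.adicCompletion L) × (Fin 2 → w₀.1.adicCompletion L)))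
    (hK1 : ∀ (x : (Fin (n' + n') → v.adicCompletion (Fp L))) (j : Fin 2), ![(κ x).1 j, (κ x).2.1 j, (κ x).2.2 j] ᵥ* P = fun l => halfDiff ((eD (Fp L) L (IsCMField.complexConj L) (complexConj_imagUnit L) (imagUnit_ne_zero L) (imagUnit_mul_self L) v n').symm (toLin (Fp L) v E'⁻¹ (x, 0))) (epsV e eW e' (j, l)) w₀)
    (p : UnitaryGroup.localPi L (IsCMField.complexConj L) (2 + 2) (hermD L e dV hdV dW hdW) v)
    (hp : IsSiegelDelta (Fp L) L (IsCMField.complexConj L) (complexConj_imagUnit L) (imagUnit_ne_zero L) (imagUnit_mul_self L) v 2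
      (gramR_isSymm L e dV hdV dW hdW) (hermD_eq_map_gramD L e dV hdV dW hdW) p)
    (B : GL (Fin (n' + n')) (v.adicCompletion (Fp L)))
    (hB : E' * iotaD (Fp L) L (IsCMField.complexConj L) (complexConj_imagUnit L) (imagUnit_ne_zero L) (imagUnit_mul_self L) v n'
        (gramR_isSymm L e' dV hdV (tensorFrame L dW eW dV') (tensorFrame_real L dW hdW eW dV' hdV'))
        (hermD_eq_map_gramD L e' dV hdV (tensorFrame L dW eW dV') (tensorFrame_real L dW hdW eW dV' hdV'))
        (tensorEmbLoc L e dV hdV dW hdW eW e' dV' hdV' v p) * E'⁻¹ =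
      transportSp (localGram (Fp L) (n' + n') (gramD (Fp L) n' (gramR L e' dV hdV (tensorFrame L dW eW dV') (tensorFrame_real L dW hdW eW dV' hdV'))) v) hTv (levi B))
    (z : Fin (n' + n') → v.adicCompletion (Fp L)) (i₀ : Fin 2) (α β γ : w₀.1.adicCompletion L)
    (hz : (κ z).1 = α • Pi.single i₀ 1 ∧ (κ z).2.1 = β • Pi.single i₀ 1 ∧ (κ z).2.2 = γ • Pi.single i₀ 1) :
    (κ (((B⁻¹ : GL (Fin (n' + n')) (v.adicCompletion (Fp L))) : Matrix (Fin (n' + n')) (Fin (n' + n')) (v.adicCompletion (Fp L))) *ᵥ z)).1 =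
        (fun j => α * (blkD (matA (Fp L) L (IsCMField.complexConj L) v 2 p⁻¹) j i₀) w₀) ∧
      (κ (((B⁻¹ : GL (Fin (n' + n')) (v.adicCompletion (Fp L))) : Matrix (Fin (n' + n')) (Fin (n' + n')) (v.adicCompletion (Fp L))) *ᵥ z)).2.1 =
        (fun j => β * (blkD (matA (Fp L) L (IsCMField.complexConj L) v 2 p⁻¹) j i₀) w₀) ∧
      (κ (((B⁻¹ : GL (Fin (n' + n')) (v.adicCompletion (Fp L))) : Matrix (Fin (n' + n')) (Fin (n' + n')) (v.adicCompletion (Fp L))) *ᵥ z)).2.2 =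
        (fun j => γ * (blkD (matA (Fp L) L (IsCMField.complexConj L) v 2 p⁻¹) j i₀) w₀) := by
  obtain ⟨h1, h2, h3⟩ := kappa_inv_levi_of_row_reading L e dV hdV dW hdW eW e' dV' hdV' v w₀ hTv E' P hPu κ hK1 p hp B hB z α β γ
    (Pi.single i₀ 1) hz
  -- `D ·ᵥ e_{i₀}` is the `i₀`-th column of `D`
  have hcol : (blkD (matA (Fp L) L (IsCMField.complexConj L) v 2 p⁻¹)).map (fun t : LocalRing L v => t w₀) *ᵥ (Pi.single i₀ (1 : w₀.1.adicCompletion L)) =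
      fun j => (blkD (matA (Fp L) L (IsCMField.complexConj L) v 2 p⁻¹) j i₀) w₀ := by
    rw [Matrix.mulVec_single_one]
    funext j
    rw [Matrix.col_apply, Matrix.map_apply]
  have hrow : ∀ a : w₀.1.adicCompletion L,
      a • ((blkD (matA (Fp L) L (IsCMField.complexConj L) v 2 p⁻¹)).map (fun t : LocalRing L v => t w₀) *ᵥ (Pi.single i₀ (1 : w₀.1.adicCompletion L))) =
        fun j => a * (blkD (matA (Fp L) L (IsCMField.complexConj L) v 2 p⁻¹) j i₀) w₀ := by
    intro a
    rw [hcol]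
    funext j
    rw [Pi.smul_apply, smul_eq_mul]
  exact ⟨h1.trans (hrow α), h2.trans (hrow β), h3.trans (hrow γ)⟩

end Summit.HodgeConjecture.HodgeConjecture.Cruxes.HLiu418.K2LiuTensorMiddleCellFrameReading

end
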